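import Literature.NumberTheory.EllipticCurves.EichlerShimuraPeriods
import HarnessLib

/-!
# The derivative `θ = q d/dq` of a cuspidal `q`-series function

Topic `NumberTheory/EllipticCurves`; a proofs-only file (theorems only, no definitions, no named
facts) extending the tree's `IsCuspFunction` API (`ModularSymbolsProofs.lean`,
`EichlerShimuraPeriods.lean`): `φ : ℍ → ℂ` with `φ ∘ ofComplex` `h`-periodic, `φ` holomorphic and
`φ → 0` at `i∞`, so that `φ(τ) = Σ_{n ≥ 1} cₙ q_h(τ)ⁿ`, `q_h = e^{2πiτ/h}`
(Mathlib `UpperHalfPlane.hasSum_qExpansion`).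

Main results (Diamond–Shurman §1.1–1.2, `q`-expansions; Zagier, *Elliptic modular forms and their
applications* (in *The 1-2-3 of Modular Forms*), §5.1: the derivative `D = (2πi)⁻¹ d/dz = q d/dq`
acts on `q`-expansions by `Σ aₙqⁿ ↦ Σ n aₙ qⁿ`):

* `IsCuspFunction.mul`, `IsCuspFunction.pow`, `IsCuspFunction.sub` — closure properties
  (with the tree's `add`, `const_smul`), and `IsCuspFunction.analyticAt_cuspFunction_zero`,
  so that Mathlib's `qExpansion_mul/add/sub/smul` apply to cusp functions;
* `IsCuspFunction.hasSum_deriv_comp_ofComplex` — **termwise differentiation**: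
  `d/dz φ(z) = Σ (2πi n/h) cₙ q_h(z)ⁿ` on the upper half-plane (locally uniform convergence,
  Mathlib `hasDerivAt_tsum_of_isPreconnected`, as in the tree's `hasDerivAt_verticalIntegral`);
* `IsCuspFunction.deriv` — `τ ↦ d/dz φ(τ)` is again a cusp function of period `h`;
* `IsCuspFunction.qExpansion_coeff_deriv` — its `q`-expansion is `Σ (2πi n/h) cₙ qⁿ`
  (uniqueness of `q`-expansions, Mathlib `qExpansion_coeff_unique`).

## References

* F. Diamond, J. Shurman, *A First Course in Modular Forms*, GTM 228, Springer 2005: §1.1–1.2.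
  [DiamondShurman2005]
* D. Zagier, *Elliptic modular forms and their applications*, in: The 1-2-3 of Modular Forms,
  Universitext, Springer 2008: §5.1 (derivatives of modular forms).
-/

noncomputable section

open Complex Filter Topology Set Function
open UpperHalfPlane hiding I
open scoped Real Topology Manifold

namespace Literature.NumberTheory.EllipticCurves.ModularForms

/-! ### Uniqueness of `q`-expansion coefficients, for plain functions -/

/-- **Uniqueness of `q`-expansions** for a function `f : ℍ → ℂ` (Mathlib's
`qExpansion_coeff_unique`, which is stated for bundled `FunLike` types): if the cusp function of
`f` is analytic at `0` and `f(τ) = Σ cₘ q_h(τ)ᵐ` on `ℍ`, then `cₘ` is the `m`-th `q`-expansion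
coefficient (both `Σ cₘ qᵐ` and the Taylor series represent the cusp function near `0`).
[folklore] -/
theorem qExpansion_coeff_eq_of_hasSum {h : ℝ} {f : ℍ → ℂ} {c : ℕ → ℂ} (hh : 0 < h)
    (hfanalytic : AnalyticAt ℂ (cuspFunction h f) 0)
    (hf : ∀ τ : ℍ, HasSum (fun m : ℕ ↦ c m • Periodic.qParam h τ ^ m) (f τ)) (m : ℕ) :
    (qExpansion h f).coeff m = c m := by
  have h1 := (hasFPowerSeriesOnBall_cuspFunction hh hfanalytic hf).hasFPowerSeriesAt
  have h2 := hfanalytic.hasFPowerSeriesAt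
  have h3 := congr_arg (fun p : FormalMultilinearSeries ℂ ℂ ℂ ↦ p.coeff m)
    (h1.eq_formalMultilinearSeries h2)
  simp only [FormalMultilinearSeries.coeff_ofScalars] at h3
  rw [qExpansion_coeff, h3, div_eq_inv_mul]

namespace IsCuspFunction

variable {h : ℝ} {φ ψ : ℍ → ℂ} (hφ : IsCuspFunction h φ)
include hφ

/-! ### Closure properties -/

omit hφ in
/-- Cusp functions are stable under multiplication (`φψ → 0` at `i∞` as zero times bounded).
[folklore] -/
theorem mul (hφ : IsCuspFunction h φ) (hψ : IsCuspFunction h ψ) : IsCuspFunction h (φ * ψ) where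
  pos := hφ.pos
  periodic := by
    intro w
    have h1 := hφ.periodic w
    have h2 := hψ.periodic w
    simp only [comp_apply, Pi.mul_apply] at h1 h2 ⊢
    rw [h1, h2]
  mdifferentiable := hφ.mdifferentiable.mul hψ.mdifferentiable
  isZeroAtImInfty := hφ.isZeroAtImInfty.mul_boundedAtFilter hψ.isBoundedAtImInfty

/-- Cusp functions are stable under powers `φⁿ`, `n ≥ 1`. [folklore] -/
theorem pow (n : ℕ) : IsCuspFunction h (φ ^ (n + 1)) := by
  induction n with
  | zero => simpa using hφ
  | succ n ih =>
    rw [pow_succ]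
    exact ih.mul hφ

/-- Cusp functions are stable under negation. [folklore] -/
theorem neg : IsCuspFunction h (-φ) := by
  simpa using hφ.const_smul (-1)

omit hφ in
/-- Cusp functions are stable under subtraction. [folklore] -/
theorem sub (hφ : IsCuspFunction h φ) (hψ : IsCuspFunction h ψ) : IsCuspFunction h (φ - ψ) := by
  simpa [sub_eq_add_neg] using hφ.add hψ.neg

/-- The cusp function (`q ↦ φ`, extended to `q = 0`) of a cusp function is analytic at `0`
(Mathlib `analyticAt_cuspFunction_zero`). [folklore] -/
theorem analyticAt_cuspFunction_zero : AnalyticAt ℂ (cuspFunction h φ) 0 :=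
  UpperHalfPlane.analyticAt_cuspFunction_zero hφ.pos hφ.periodic hφ.mdifferentiable
    hφ.isBoundedAtImInfty

/-- `φ ∘ ofComplex` is holomorphic on the upper half-plane. [folklore] -/
theorem differentiableOn_comp_ofComplex : DifferentiableOn ℂ (φ ∘ ofComplex) {z : ℂ | 0 < z.im} :=
  UpperHalfPlane.mdifferentiable_iff.mp hφ.mdifferentiable

/-- `φ ∘ ofComplex` is analytic at every point of the upper half-plane. [folklore] -/
theorem analyticAt_comp_ofComplex {z : ℂ} (hz : 0 < z.im) : AnalyticAt ℂ (φ ∘ ofComplex) z :=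
  hφ.differentiableOn_comp_ofComplex.analyticAt (isOpen_upperHalfPlaneSet.mem_nhds hz)

/-! ### Termwise differentiation of the `q`-expansion -/

omit hφ in
/-- Each term `cₙ q_h(w)ⁿ = cₙ e^{2πinw/h}` has derivative `(2πin/h) cₙ q_h(w)ⁿ`. [folklore] -/
theorem hasDerivAt_qExpansion_term (n : ℕ) (w : ℂ) :
    HasDerivAt (fun w : ℂ ↦ (qExpansion h φ).coeff n * Periodic.qParam h w ^ n)
      (2 * π * I * n / h * ((qExpansion h φ).coeff n * Periodic.qParam h w ^ n)) w := by
  have hq : ∀ w : ℂ, Periodic.qParam h w ^ n = cexp ((2 * π * I * n / h) * w) := by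
    intro w
    rw [Periodic.qParam, ← Complex.exp_nat_mul]
    congr 1
    ring
  simp_rw [hq]
  have h1 : HasDerivAt (fun w : ℂ ↦ cexp ((2 * π * I * n / h) * w))
      (cexp ((2 * π * I * n / h) * w) * (2 * π * I * n / h)) w := by
    have := ((hasDerivAt_id w).const_mul (2 * π * I * n / h)).cexp
    simpa using this
  refine (h1.const_mul ((qExpansion h φ).coeff n)).congr_deriv ?_
  ring

/-- `Σ n ‖cₙ‖ rⁿ < ∞` for `0 ≤ r < 1` (compare with `Σ ‖cₙ‖ sⁿ` at `s = √r`, `n √rⁿ` being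
bounded). [folklore] -/
theorem summable_nat_mul_norm_coeff_mul_pow {r : ℝ} (hr0 : 0 ≤ r) (hr : r < 1) :
    Summable fun n : ℕ ↦ (n : ℝ) * ‖(qExpansion h φ).coeff n‖ * r ^ n := by
  set s : ℝ := Real.sqrt r with hs
  have hs0 : 0 ≤ s := Real.sqrt_nonneg r
  have hs1 : s < 1 := by
    rw [hs, Real.sqrt_lt' one_pos]
    simpa using hr
  have hsr : s * s = r := Real.mul_self_sqrt hr0
  have hsum := hφ.summable_norm_coeff_mul_pow hs0 hs1
  -- `n sⁿ → 0`, so eventually `n sⁿ ≤ 1`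
  have ht : Tendsto (fun n : ℕ ↦ (n : ℝ) * s ^ n) atTop (𝓝 0) :=
    tendsto_self_mul_const_pow_of_abs_lt_one (by rwa [abs_of_nonneg hs0])
  have hev : ∀ᶠ n : ℕ in atTop, (n : ℝ) * s ^ n ≤ 1 :=
    (ht.eventually (ge_mem_nhds one_pos))
  refine hsum.of_norm_bounded_eventually_nat ?_
  filter_upwards [hev] with n hn
  rw [Real.norm_of_nonneg (by positivity)]
  calc (n : ℝ) * ‖(qExpansion h φ).coeff n‖ * r ^ n
      = ((n : ℝ) * s ^ n) * (‖(qExpansion h φ).coeff n‖ * s ^ n) := by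
        rw [← hsr, mul_pow]; ring
    _ ≤ 1 * (‖(qExpansion h φ).coeff n‖ * s ^ n) := by gcongr
    _ = ‖(qExpansion h φ).coeff n‖ * s ^ n := one_mul _

/-- **Termwise differentiation of the `q`-expansion**: for `im z > 0`,
`d/dz φ(z) = Σₙ (2πi n/h) cₙ q_h(z)ⁿ` (the `q`-series converges locally uniformly on the upper
half-plane; Diamond–Shurman §1.1). [folklore] -/
theorem hasSum_deriv_comp_ofComplex {z : ℂ} (hz : 0 < z.im) :
    HasSum (fun n : ℕ ↦ 2 * π * I * n / h * ((qExpansion h φ).coeff n * Periodic.qParam h z ^ n))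
      (deriv (φ ∘ ofComplex) z) := by
  have hh := hφ.pos
  set c : ℕ → ℂ := fun n ↦ (qExpansion h φ).coeff n with hc
  set y : ℝ := z.im / 2 with hy
  have hy0 : 0 < y := by positivity
  set U : Set ℂ := {w : ℂ | y < w.im}
  have hUo : IsOpen U := isOpen_lt continuous_const Complex.continuous_im
  have hUc : IsPreconnected U := (convex_halfSpace_im_gt y).isPreconnected
  have hzU : z ∈ U := by simp [U, hy]; linarith
  have hUpos : ∀ w ∈ U, 0 < w.im := fun w hw ↦ hy0.trans hw
  set ρ : ℝ := Real.exp (-2 * π * y / h)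
  have hρ0 : 0 ≤ ρ := (Real.exp_pos _).le
  have hρ1 : ρ < 1 := by
    apply Real.exp_lt_one_iff.mpr
    have : 0 < 2 * π * y / h := by positivity
    rw [neg_mul, neg_mul, neg_div]
    linarith
  have hqU : ∀ w ∈ U, ‖Periodic.qParam h w‖ ≤ ρ := by
    intro w hw
    rw [Periodic.norm_qParam]
    apply Real.exp_le_exp.mpr
    have : 2 * π * y / h ≤ 2 * π * w.im / h := by
      gcongr
      exact le_of_lt hw
    have e1 : -2 * π * w.im / h = -(2 * π * w.im / h) := by ring
    have e2 : -2 * π * y / h = -(2 * π * y / h) := by ring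
    rw [e1, e2]
    linarith
  -- bound for the derivatives on `U`
  have hbd : ∀ n (w : ℂ), w ∈ U →
      ‖2 * π * I * n / h * (c n * Periodic.qParam h w ^ n)‖ ≤ 2 * π / h * (n * ‖c n‖ * ρ ^ n) := by
    intro n w hw
    have e : ‖2 * (π : ℂ) * I * n / h‖ = 2 * π * n / h := by
      simp only [norm_div, norm_mul, Complex.norm_real, Complex.norm_I, Complex.norm_natCast,
        Real.norm_eq_abs, abs_of_pos Real.pi_pos, abs_of_pos hh, mul_one, Complex.norm_ofNat]
    rw [norm_mul, e, norm_mul, norm_pow]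
    have : 2 * π * n / h * (‖c n‖ * ‖Periodic.qParam h w‖ ^ n) ≤
        2 * π * n / h * (‖c n‖ * ρ ^ n) := by
      gcongr
      exact hqU w hw
    refine this.trans_eq ?_
    ring
  have hsumρ : Summable fun n : ℕ ↦ 2 * π / h * (n * ‖c n‖ * ρ ^ n) :=
    (hφ.summable_nat_mul_norm_coeff_mul_pow hρ0 hρ1).mul_left _
  have hz0 : Summable fun n ↦ c n * Periodic.qParam h z ^ n := (hφ.hasSum ⟨z, hz⟩).summable
  have H := hasDerivAt_tsum_of_isPreconnected hsumρ hUo hUc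
    (fun n w _ ↦ hasDerivAt_qExpansion_term n w) hbd hzU hz0 hzU
  -- identify the function with `φ ∘ ofComplex` near `z`
  have hfun : (fun w : ℂ ↦ ∑' n, c n * Periodic.qParam h w ^ n) =ᶠ[𝓝 z] (φ ∘ ofComplex) := by
    filter_upwards [hUo.mem_nhds hzU] with w hw
    have hsw := (hφ.hasSum ⟨w, hUpos w hw⟩).tsum_eq
    simp only [comp_apply, ofComplex_apply_of_im_pos (hUpos w hw)]
    exact hsw
  have hsum' : Summable fun n : ℕ ↦ 2 * π * I * n / h * (c n * Periodic.qParam h z ^ n) :=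
    hsumρ.of_norm_bounded (fun n ↦ hbd n z hzU)
  have hderiv : deriv (φ ∘ ofComplex) z =
      ∑' n : ℕ, 2 * π * I * n / h * (c n * Periodic.qParam h z ^ n) := by
    rw [← hfun.deriv_eq]
    exact H.deriv
  rw [hderiv]
  exact hsum'.hasSum

/-! ### The derivative is again a cusp function -/

/-- On the upper half-plane the `q`-series `Σ (2πin/h) cₙ q_h(τ)ⁿ` sums to `d/dz φ(τ)`; as a
function on `ℍ` this is `τ ↦ deriv (φ ∘ ofComplex) τ`. [folklore] -/
theorem hasSum_deriv (τ : ℍ) :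
    HasSum (fun n : ℕ ↦ (2 * π * I * n / h * (qExpansion h φ).coeff n) • Periodic.qParam h τ ^ n)
      (deriv (φ ∘ ofComplex) τ) := by
  have := hφ.hasSum_deriv_comp_ofComplex τ.im_pos
  simpa [smul_eq_mul, mul_assoc] using this

/-- The derivative `τ ↦ d/dz φ(τ)` is `h`-periodic (derivative of a periodic function; on the
closed lower half-plane `ofComplex` is constant). [folklore] -/
theorem periodic_deriv : Periodic ((fun τ : ℍ ↦ _root_.deriv (φ ∘ ofComplex) τ) ∘ ofComplex) h := by
  intro w
  by_cases hw : 0 < w.im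
  · have hw' : 0 < (w + h).im := by simpa using hw
    simp only [comp_apply, ofComplex_apply_of_im_pos hw, ofComplex_apply_of_im_pos hw',
      UpperHalfPlane.coe_mk]
    have hp : (φ ∘ ofComplex) = fun z ↦ (φ ∘ ofComplex) (z + h) := by
      funext z
      exact (hφ.periodic z).symm
    conv_rhs => rw [hp]
    rw [deriv_comp_add_const]
  · have hw' : (w + h).im ≤ 0 := by simpa using hw
    simp only [comp_apply, ofComplex_apply_eq_of_im_nonpos hw' (not_lt.mp hw)]

/-- The derivative `τ ↦ d/dz φ(τ)` is holomorphic on `ℍ`. [folklore] -/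
theorem mdifferentiable_deriv :
    MDifferentiable 𝓘(ℂ) 𝓘(ℂ) (fun τ : ℍ ↦ _root_.deriv (φ ∘ ofComplex) τ) := by
  have hdiff : DifferentiableOn ℂ (_root_.deriv (φ ∘ ofComplex)) {z : ℂ | 0 < z.im} := by
    have han : AnalyticOnNhd ℂ (φ ∘ ofComplex) {z : ℂ | 0 < z.im} := fun z hz ↦
      hφ.analyticAt_comp_ofComplex hz
    exact han.deriv.differentiableOn
  refine UpperHalfPlane.mdifferentiable_iff.mpr ?_
  refine hdiff.congr fun z hz ↦ ?_
  simp only [comp_apply, ofComplex_apply_of_im_pos hz, UpperHalfPlane.coe_mk]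

/-- The derivative `τ ↦ d/dz φ(τ)` is bounded at `i∞` (it is a convergent `q`-series, Mathlib
`isBoundedAtImInfty_of_hasSum_qExpansion`). [folklore] -/
theorem isBoundedAtImInfty_deriv :
    IsBoundedAtImInfty (fun τ : ℍ ↦ _root_.deriv (φ ∘ ofComplex) τ) :=
  isBoundedAtImInfty_of_hasSum_qExpansion hφ.pos (fun τ ↦ hφ.hasSum_deriv τ)

/-- The cusp function of `τ ↦ d/dz φ(τ)` is analytic at `q = 0`. [folklore] -/
theorem analyticAt_cuspFunction_deriv_zero :
    AnalyticAt ℂ (cuspFunction h (fun τ : ℍ ↦ _root_.deriv (φ ∘ ofComplex) τ)) 0 :=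
  UpperHalfPlane.analyticAt_cuspFunction_zero hφ.pos hφ.periodic_deriv hφ.mdifferentiable_deriv
    hφ.isBoundedAtImInfty_deriv

/-- The `q`-expansion of `τ ↦ d/dz φ(τ)` has vanishing constant term. [folklore] -/
theorem qExpansion_coeff_deriv_zero :
    (qExpansion h (fun τ : ℍ ↦ _root_.deriv (φ ∘ ofComplex) τ)).coeff 0 = 0 := by
  rw [qExpansion_coeff_eq_of_hasSum hφ.pos hφ.analyticAt_cuspFunction_deriv_zero
    (fun τ ↦ hφ.hasSum_deriv τ) 0]
  simp

/-- The cusp function of `τ ↦ d/dz φ(τ)` vanishes at `q = 0` (the `q`-series has no constant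
term). [folklore] -/
theorem cuspFunction_deriv_zero :
    cuspFunction h (fun τ : ℍ ↦ _root_.deriv (φ ∘ ofComplex) τ) 0 = 0 := by
  rw [cuspFunction_apply_zero hφ.pos hφ.analyticAt_cuspFunction_deriv_zero hφ.periodic_deriv,
    ← qExpansion_coeff_zero hφ.pos hφ.analyticAt_cuspFunction_deriv_zero hφ.periodic_deriv,
    hφ.qExpansion_coeff_deriv_zero]

/-- **The derivative of a cusp function is a cusp function**: `τ ↦ d/dz φ(τ)` is `h`-periodic,
holomorphic, and tends to `0` at `i∞` (its cusp function is continuous at `0` with value `0`).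
[folklore] -/
theorem deriv : IsCuspFunction h (fun τ : ℍ ↦ _root_.deriv (φ ∘ ofComplex) τ) := by
  have hh := hφ.pos
  have hzero : IsZeroAtImInfty (fun τ : ℍ ↦ _root_.deriv (φ ∘ ofComplex) τ) := by
    have hcont := hφ.analyticAt_cuspFunction_deriv_zero.continuousAt
    have hcomp : (cuspFunction h (fun τ : ℍ ↦ _root_.deriv (φ ∘ ofComplex) τ) ∘
        fun τ : ℍ ↦ Periodic.qParam h τ) = fun τ : ℍ ↦ _root_.deriv (φ ∘ ofComplex) τ := by
      funext τ
      simpa using eq_cuspFunction τ hh.ne' hφ.periodic_deriv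
    have ht := hcont.tendsto.comp (qParam_tendsto_atImInfty hh)
    rw [hcomp, hφ.cuspFunction_deriv_zero] at ht
    exact ht
  exact ⟨hh, hφ.periodic_deriv, hφ.mdifferentiable_deriv, hzero⟩

/-- **`q`-expansion of the derivative**: the `n`-th coefficient of `τ ↦ d/dz φ(τ)` is
`(2πi n/h) cₙ` (Zagier §5.1; uniqueness of `q`-expansions, `qExpansion_coeff_eq_of_hasSum`).
[folklore] -/
theorem qExpansion_coeff_deriv (n : ℕ) :
    (qExpansion h (fun τ : ℍ ↦ _root_.deriv (φ ∘ ofComplex) τ)).coeff n =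
      2 * π * I * n / h * (qExpansion h φ).coeff n := by
  exact qExpansion_coeff_eq_of_hasSum hφ.pos hφ.analyticAt_cuspFunction_deriv_zero
    (fun τ ↦ hφ.hasSum_deriv τ) n

end IsCuspFunction

end Literature.NumberTheory.EllipticCurves.ModularForms

end
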